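import Summits.AtomisticToContinuum.HydrodynamicLimit.Theorems.AntiMazurCoboundariesCellForecastPressureDecayKinematicAssemblyKernelSum
import Summits.AtomisticToContinuum.HydrodynamicLimit.Theorems.AntiMazurCoboundariesCellForecastPressureDecayClusterTailInsertion
import HarnessLib

/-!
# S2d′ · kinematic assembly from the cluster tail, piece 6: the static main term under the cell law
# (registered sub-goal `stub_kinematicAssemblyOfTail_staticMain` of stub `stub_kinematicAssemblyOfTail`, crux line
# `enskog-compensator-martingale`, crux `CellForecastPressureDecay`, stmt-AtomisticToContinuum-13915)

The STATIC main term of `KinematicRates σ` (stub S2d′) under the canonical cell law: for a family of pair functionals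
`φ_{v,u}` as in `stub_kinematicAssembly_mainTerm` and a velocity functional `|F| ≤ 1`,

`|E_P[F(v) · (½ ∑_{i≠j} φ_{vᵢ,vⱼ}(xᵢ − xⱼ) − Δ c ∑_{i≠j} K_w(vᵢ, vⱼ))]| ≤ C (L³Δ² + L²Δ)`, `c = c₂σ²/(2n(n−1))`,

with the contact constant `c₂` of the pair statistics. Route: the cell law factorises (`CellLawFactorises`:
`(pos, vel)_* P = posLaw ⊗ γ^{⊗n}`), so the expectation is a Gaussian average over the velocities of position
expectations (Fubini); pair by pair the static estimate `stub_kinematicAssemblyOfTail_statics` bounds the integrand by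
`E₀ (1 + ‖vᵢ − vⱼ‖)⁴`, and the Gaussian fourth moments are finite (`stub_kinematicAssemblyOfTail_kernelSum`). The file
also records the integrability of the two sums under the cell law and the crude bound
`|E_P[F ∑_{i≠j} K_w(vᵢ, vⱼ)]| ≤ 64 b π n² M₄` used for long slabs.

References: Cercignani–Illner–Pulvirenti 1994, §2.2, §4.3; Spohn 1991, Part I §2.3.
-/

noncomputable section

open MeasureTheory ProbabilityTheory Set Filter Topology
open scoped ENNReal BigOperators InnerProductSpace
open Literature.Analysis.FluidPDE Literature.MathematicalPhysics.KineticTheory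

namespace Summit.AtomisticToContinuum.HydrodynamicLimit.Theorems.EnskogCompensator

/-! ## Expectations under the cell law through the factorisation -/

section CellLaw

variable {σ : ℝ} (hfac : CellLawFactorises σ) (L : ℝ) (n : ℕ) (Ψ : Flows σ)
include hfac

/-- **Expectations under the cell law are expectations under `posLaw ⊗ γ^{⊗n}`** of the same function of
(positions, velocities) (`CellLawFactorises`, change of variables along the measurable equivalence `z ↦ (pos z, vel z)`).
[folklore] -/
theorem integral_cellLaw_eq_prod (H : (Fin n → V3) × (Fin n → V3) → ℝ) :
    ∫ z, H (fun i => (z i).1, fun i => (z i).2) ∂cellLaw σ L n Ψ =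
      ∫ p, H p ∂((posLaw σ L n).prod (Measure.pi fun _ : Fin n => stdGaussian V3)) := by
  set e := MeasurableEquiv.arrowProdEquivProdArrow V3 V3 (Fin n) with he
  have hpv : (fun z : Cell n => (pos z, vel z)) = ⇑e := rfl
  rw [← hfac L n Ψ, hpv, integral_map_equiv]
  rfl

/-- Integrability under the cell law from integrability under `posLaw ⊗ γ^{⊗n}`. [folklore] -/
theorem integrable_cellLaw_of_prod {H : (Fin n → V3) × (Fin n → V3) → ℝ}
    (hH : Integrable H ((posLaw σ L n).prod (Measure.pi fun _ : Fin n => stdGaussian V3))) :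
    Integrable (fun z : Cell n => H (fun i => (z i).1, fun i => (z i).2)) (cellLaw σ L n Ψ) := by
  set e := MeasurableEquiv.arrowProdEquivProdArrow V3 V3 (Fin n) with he
  have hpv : (fun z : Cell n => (pos z, vel z)) = ⇑e := rfl
  rw [← hfac L n Ψ, hpv] at hH
  exact (integrable_map_equiv e H).1 hH

end CellLaw

/-! ## The main term under the cell law -/

section Main

variable {σ L : ℝ} {n : ℕ} (hfac : CellLawFactorises σ) (Ψ : Flows σ) [IsProbabilityMeasure (posLaw σ L n)]
  {w : V3 → ℝ} {b : ℝ} (hw : Continuous w) (hwb : ∀ x, |w x| ≤ b) {Δ c : ℝ}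
  {φ : V3 → V3 → V3 → ℝ} (hφm : Measurable fun p : V3 × V3 × V3 => φ p.1 p.2.1 p.2.2) (hφb : ∀ v u q, |φ v u q| ≤ 4 * b)
  {F : (Fin n → V3) → ℝ} (hF : Measurable F) (hFb : ∀ v, |F v| ≤ 1)
include hfac hw hwb hφm hφb hF hFb

omit hfac hw hwb hF hFb in
/-- For fixed velocities, `x ↦ φ_{vᵢ,vⱼ}(xᵢ − xⱼ)` restricted to `i ≠ j` is integrable under the position law. [folklore] -/
theorem integrable_pairTerm_pos (v : Fin n → V3) (i j : Fin n) :
    Integrable (fun x : Fin n → V3 => (if i = j then 0 else φ (v i) (v j) (x i - x j))) (posLaw σ L n) := by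
  have hb4 : 0 ≤ 4 * b := (abs_nonneg _).trans (hφb 0 0 0)
  refine Integrable.of_bound ?_ (4 * b) (ae_of_all _ fun x => ?_)
  · have h2 : Measurable fun x : Fin n → V3 => (v i, v j, x i - x j) :=
      measurable_const.prodMk (measurable_const.prodMk ((measurable_pi_apply i).sub (measurable_pi_apply j)))
    have h3 : Measurable fun x : Fin n → V3 => φ (v i) (v j) (x i - x j) := hφm.comp h2
    by_cases hij : i = j
    · simp only [if_pos hij]
      exact aestronglyMeasurable_const
    · simp only [if_neg hij]
      exact h3.aestronglyMeasurable
  · rw [Real.norm_eq_abs]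
    split_ifs
    · rw [abs_zero]; exact hb4
    · exact hφb _ _ _

/-- **Fubini for the main term**: the cell-law expectation of `F(v) (½ ∑_{i≠j} φ_{vᵢ,vⱼ}(xᵢ − xⱼ) − Δ c ∑_{i≠j} K_w(vᵢ, vⱼ))`
is the Gaussian average over the velocities of `F(v) (½ ∑_{i≠j} E_pos φ_{vᵢ,vⱼ}(xᵢ − xⱼ) − Δ c ∑_{i≠j} K_w(vᵢ, vⱼ))`,
and the two sums are integrable under the cell law. [folklore] -/
theorem integral_cellLaw_main_eq :
    Integrable (fun z : Cell n => F (fun i => (z i).2) *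
      ∑ i, ∑ j, (if i = j then 0 else pairKernel w (z i).2 (z j).2)) (cellLaw σ L n Ψ) ∧
    Integrable (fun z : Cell n => F (fun i => (z i).2) *
      ∑ i, ∑ j, (if i = j then 0 else φ (z i).2 (z j).2 ((z i).1 - (z j).1))) (cellLaw σ L n Ψ) ∧
    ∫ z, F (fun i => (z i).2) * ∑ i, ∑ j, (if i = j then 0 else pairKernel w (z i).2 (z j).2) ∂(cellLaw σ L n Ψ) =
      ∫ v, F v * ∑ i, ∑ j, (if i = j then 0 else pairKernel w (v i) (v j)) ∂(Measure.pi fun _ : Fin n => stdGaussian V3) ∧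
    ∫ z, F (fun i => (z i).2) * ((1 / 2) * ∑ i, ∑ j, (if i = j then 0 else φ (z i).2 (z j).2 ((z i).1 - (z j).1)) -
        Δ * c * ∑ i, ∑ j, (if i = j then 0 else pairKernel w (z i).2 (z j).2)) ∂(cellLaw σ L n Ψ) =
      ∫ v, F v * ((1 / 2) * ∑ i, ∑ j, (if i = j then 0 else ∫ x, φ (v i) (v j) (x i - x j) ∂(posLaw σ L n)) -
        Δ * c * ∑ i, ∑ j, (if i = j then 0 else pairKernel w (v i) (v j))) ∂(Measure.pi fun _ : Fin n => stdGaussian V3) := by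
  set γn : Measure (Fin n → V3) := Measure.pi fun _ : Fin n => stdGaussian V3 with hγn
  have hb : 0 ≤ b := (abs_nonneg _).trans (hwb 0)
  -- the kernel sum
  obtain ⟨hKi, -⟩ := integrable_kernelSum_pi n hw hwb hF hFb
  have hK2 : Integrable (fun p : (Fin n → V3) × (Fin n → V3) =>
      F p.2 * ∑ i, ∑ j, (if i = j then 0 else pairKernel w (p.2 i) (p.2 j))) ((posLaw σ L n).prod γn) :=
    hKi.comp_snd (posLaw σ L n)
  have hKP := integrable_cellLaw_of_prod hfac L n Ψ hK2
  -- the static sum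
  have hSm : Measurable fun p : (Fin n → V3) × (Fin n → V3) =>
      F p.2 * ∑ i, ∑ j, (if i = j then 0 else φ (p.2 i) (p.2 j) (p.1 i - p.1 j)) := by
    refine (hF.comp measurable_snd).mul (Finset.measurable_sum _ fun i _ => Finset.measurable_sum _ fun j _ => ?_)
    have h2 : Measurable fun p : (Fin n → V3) × (Fin n → V3) => (p.2 i, p.2 j, p.1 i - p.1 j) :=
      ((measurable_pi_apply i).comp measurable_snd).prodMk (((measurable_pi_apply j).comp measurable_snd).prodMk
        (((measurable_pi_apply i).comp measurable_fst).sub ((measurable_pi_apply j).comp measurable_fst)))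
    have h3 : Measurable fun p : (Fin n → V3) × (Fin n → V3) => φ (p.2 i) (p.2 j) (p.1 i - p.1 j) := hφm.comp h2
    by_cases hij : i = j
    · simp only [if_pos hij]
      exact measurable_const
    · simp only [if_neg hij]
      exact h3
  have hSb : ∀ p : (Fin n → V3) × (Fin n → V3),
      |F p.2 * ∑ i, ∑ j, (if i = j then 0 else φ (p.2 i) (p.2 j) (p.1 i - p.1 j))| ≤ 4 * b * (n * n) := fun p => by
    rw [abs_mul]
    have h := abs_pairSum_le (n := n) hφb (fun k => (p.1 k, p.2 k))
    exact (mul_le_mul (hFb _) h (abs_nonneg _) zero_le_one).trans_eq (one_mul _)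
  have hS2 : Integrable (fun p : (Fin n → V3) × (Fin n → V3) =>
      F p.2 * ∑ i, ∑ j, (if i = j then 0 else φ (p.2 i) (p.2 j) (p.1 i - p.1 j))) ((posLaw σ L n).prod γn) :=
    Integrable.of_bound hSm.aestronglyMeasurable _ (ae_of_all _ fun p => by rw [Real.norm_eq_abs]; exact hSb p)
  have hSP := integrable_cellLaw_of_prod hfac L n Ψ hS2
  refine ⟨hKP, hSP, ?_, ?_⟩
  · rw [integral_cellLaw_eq_prod hfac L n Ψ (fun p : (Fin n → V3) × (Fin n → V3) =>
      F p.2 * ∑ i, ∑ j, (if i = j then 0 else pairKernel w (p.2 i) (p.2 j)))]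
    rw [integral_fun_snd (fun v : Fin n → V3 => F v * ∑ i, ∑ j, (if i = j then 0 else pairKernel w (v i) (v j))),
      probReal_univ, one_smul]
  · -- the combination, on the product
    have hQi : Integrable (fun p : (Fin n → V3) × (Fin n → V3) =>
        F p.2 * ((1 / 2) * ∑ i, ∑ j, (if i = j then 0 else φ (p.2 i) (p.2 j) (p.1 i - p.1 j)) -
          Δ * c * ∑ i, ∑ j, (if i = j then 0 else pairKernel w (p.2 i) (p.2 j)))) ((posLaw σ L n).prod γn) :=
      ((hS2.const_mul (1 / 2)).sub (hK2.const_mul (Δ * c))).congr (ae_of_all _ fun p => by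
        simp only [Pi.sub_apply]
        ring)
    rw [integral_cellLaw_eq_prod hfac L n Ψ (fun p : (Fin n → V3) × (Fin n → V3) =>
      F p.2 * ((1 / 2) * ∑ i, ∑ j, (if i = j then 0 else φ (p.2 i) (p.2 j) (p.1 i - p.1 j)) -
        Δ * c * ∑ i, ∑ j, (if i = j then 0 else pairKernel w (p.2 i) (p.2 j)))), integral_prod_symm _ hQi]
    refine integral_congr_ae (ae_of_all _ fun v => ?_)
    dsimp only
    have hIi := integrable_pairTerm_pos (σ := σ) (L := L) hφm hφb v
    rw [integral_const_mul, integral_sub ((integrable_finsetSum _ fun i _ => integrable_finsetSum _ fun j _ =>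
        hIi i j).const_mul _) (integrable_const _), integral_const_mul, integral_const, probReal_univ, one_smul,
      integral_finsetSum _ fun i _ => integrable_finsetSum _ fun j _ => hIi i j]
    congr 3
    refine Finset.sum_congr rfl fun i _ => ?_
    rw [integral_finsetSum _ fun j _ => hIi i j]
    refine Finset.sum_congr rfl fun j _ => ?_
    split_ifs
    · simp
    · rfl

end Main

/-! ## The registered sub-goal: the static main term under the cell law -/

/-- The number of ordered pairs times a constant: `∑ᵢ ∑ⱼ [i ≠ j] c = c · n(n − 1)`. [folklore] -/
theorem sum_sum_ite_const (n : ℕ) (c : ℝ) :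
    (∑ i : Fin n, ∑ j : Fin n, (if i = j then (0 : ℝ) else c)) = c * (n * (n - 1)) := by
  rw [← sum_sum_ite_one n, Finset.mul_sum]
  refine Finset.sum_congr rfl fun i _ => ?_
  rw [Finset.mul_sum]
  refine Finset.sum_congr rfl fun j _ => ?_
  split_ifs <;> simp

/-- **Registered sub-goal `stub_kinematicAssemblyOfTail_staticMain`** (piece of stub `stub_kinematicAssemblyOfTail`,
S2d′, of the line `enskog-compensator-martingale`): **the static main term of the equal-time kinematics under the cell
law.** For `0 < σ ≤ 3/16`, the factorisation of the cell law, `L ≥ 1`, `n ≤ 2L³`, constants `c₂, C_CS` of the pair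
statistics and `C_CLB` of the contact-layer bound (a) at `(L, n)` with `c₂ ≤ K L³`, a continuous `|w| ≤ b`, a slab
`0 < Δ ≤ 1`, a jointly measurable family `φ_{v,u}` of pair functionals (`|φ| ≤ 4b`, supported in
`σ ≤ ‖q‖ ≤ σ + Δ‖v − u‖`, `∫ φ_{v,u} = σ²Δ K_w(v, u)`) and a measurable velocity functional `|F| ≤ 1`: the sums
`F ∑_{i≠j} K_w(vᵢ, vⱼ)` and `F ∑_{i≠j} φ_{vᵢ,vⱼ}(xᵢ − xⱼ)` are integrable under the cell law,
`|E_P[F ∑_{i≠j} K_w(vᵢ, vⱼ)]| ≤ 64 b π n² M₄`, and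
`|E_P[F (½ ∑_{i≠j} φ_{vᵢ,vⱼ}(xᵢ − xⱼ) − Δ c ∑_{i≠j} K_w(vᵢ, vⱼ))]| ≤ 8 M₄ (4bC_CS + 32bC_CLB + 4bπσ²K)(L³Δ² + L²Δ)`
with `c = c₂σ²/(2n(n−1))`, `M₄ = ∫ (1 + ‖w‖)⁴ dγ` (Fubini through the factorisation, the static pair estimate, Gaussian
fourth moments). [cite: CIP1994, §4.3] -/
theorem stub_kinematicAssemblyOfTail_staticMain : ∀ (σ L : ℝ) (n : ℕ) (Ψ : Flows σ) (C_CS c₂ C_CLB K b Δ : ℝ)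
    (w : V3 → ℝ) (φ : V3 → V3 → V3 → ℝ) (F : (Fin n → V3) → ℝ), 0 < σ → σ ≤ 3 / 16 → CellLawFactorises σ → 1 ≤ L →
    (n : ℝ) ≤ 2 * L ^ 3 → 0 ≤ C_CS → 0 ≤ c₂ → 0 ≤ C_CLB →
    (∀ r : ℝ, 0 ≤ r → r ≤ 1 → ∀ ψ : V3 → ℝ, Measurable ψ → (∀ q, |ψ q| ≤ 1) →
      (∀ q, ψ q ≠ 0 → σ ≤ ‖q‖ ∧ ‖q‖ ≤ σ + r) →
        |(∑ i : Fin n, ∑ j : Fin n, if i = j then 0 else ∫ x, ψ (x i - x j) ∂(posLaw σ L n)) - c₂ * ∫ q, ψ q| ≤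
          C_CS * (r * L ^ 2 + r ^ 2 * L ^ 3)) →
    (∀ r : ℝ, 0 ≤ r → ∀ i j : Fin n, i ≠ j →
      posLaw σ L n {x | ‖x i - x j‖ ≤ σ + r} ≤ ENNReal.ofReal (C_CLB * (r + r ^ 3) / L ^ 3)) →
    c₂ ≤ K * L ^ 3 → Continuous w → (∀ x, |w x| ≤ b) → 0 < Δ → Δ ≤ 1 →
    Measurable (fun p : V3 × V3 × V3 => φ p.1 p.2.1 p.2.2) → (∀ v u q, |φ v u q| ≤ 4 * b) →
    (∀ v u q, φ v u q ≠ 0 → σ ≤ ‖q‖ ∧ ‖q‖ ≤ σ + Δ * ‖v - u‖) →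
    (∀ v u, ∫ q, φ v u q = σ ^ 2 * Δ * pairKernel w v u) → Measurable F → (∀ x, |F x| ≤ 1) →
      Integrable (fun z : Cell n => F (fun i => (z i).2) *
        ∑ i, ∑ j, (if i = j then 0 else pairKernel w (z i).2 (z j).2)) (cellLaw σ L n Ψ) ∧
      |∫ z, F (fun i => (z i).2) * ∑ i, ∑ j, (if i = j then 0 else pairKernel w (z i).2 (z j).2) ∂(cellLaw σ L n Ψ)| ≤
        64 * b * Real.pi * n ^ 2 * ∫ w, (1 + ‖w‖) ^ 4 ∂(stdGaussian V3) ∧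
      Integrable (fun z : Cell n => F (fun i => (z i).2) *
        ∑ i, ∑ j, (if i = j then 0 else φ (z i).2 (z j).2 ((z i).1 - (z j).1))) (cellLaw σ L n Ψ) ∧
      |∫ z, F (fun i => (z i).2) * ((1 / 2) * ∑ i, ∑ j, (if i = j then 0 else φ (z i).2 (z j).2 ((z i).1 - (z j).1)) -
          Δ * (c₂ * σ ^ 2 / (2 * (n * (n - 1)))) * ∑ i, ∑ j, (if i = j then 0 else pairKernel w (z i).2 (z j).2))
          ∂(cellLaw σ L n Ψ)| ≤
        8 * (∫ w, (1 + ‖w‖) ^ 4 ∂(stdGaussian V3)) * (4 * b * C_CS + 32 * b * C_CLB + 4 * b * Real.pi * σ ^ 2 * K) *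
          (L ^ 3 * Δ ^ 2 + L ^ 2 * Δ) := by
  intro σ L n Ψ C_CS c₂ C_CLB K b Δ w φ F hσ hσ' hfac hL hn hCS0 hc₂ hCLB0 hCS hCLB hK hw hwb hΔ hΔ1 hφm hφb hφs hφi hF hFb
  haveI hP : IsProbabilityMeasure (posLaw σ L n) := isProbabilityMeasure_posLaw (posZ_ne_zero hσ' hL hn)
  have hL0 : 0 < L := by linarith
  have hb : 0 ≤ b := (abs_nonneg _).trans (hwb 0)
  have hKn : 0 ≤ K := by
    by_contra hK'
    have : K * L ^ 3 < 0 := mul_neg_of_neg_of_pos (not_le.1 hK') (by positivity)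
    linarith
  obtain ⟨hKP, hSP, hKeq, hmain⟩ := integral_cellLaw_main_eq (L := L) hfac Ψ hw hwb hφm hφb hF hFb (Δ := Δ)
    (c := c₂ * σ ^ 2 / (2 * (n * (n - 1))))
  refine ⟨hKP, ?_, hSP, ?_⟩
  · rw [hKeq]
    exact abs_integral_le_integral_abs.trans (integrable_kernelSum_pi n hw hwb hF hFb).2
  rw [hmain]
  -- the constants
  set M₄ : ℝ := ∫ w, (1 + ‖w‖) ^ 4 ∂(stdGaussian V3) with hM₄
  set E₀ : ℝ := 4 * b * C_CS * (Δ * L ^ 2 + Δ ^ 2 * L ^ 3) / (n * (n - 1)) + 8 * b * C_CLB * Δ ^ 2 / L ^ 3 +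
    4 * b * Real.pi * σ ^ 2 * K * L ^ 3 * Δ ^ 2 / (n * (n - 1)) with hE₀
  have hN0 : (0 : ℝ) ≤ n * (n - 1) := by
    rcases Nat.eq_zero_or_pos n with h0 | h0
    · simp [h0]
    · have : (1 : ℝ) ≤ n := by exact_mod_cast h0
      exact mul_nonneg (by positivity) (by linarith)
  have hE₀0 : 0 ≤ E₀ := by positivity
  have hM₄0 : 0 ≤ M₄ := integral_nonneg fun w => by positivity
  -- the per-pair static estimate
  have hpair : ∀ (v : Fin n → V3) (i j : Fin n), i ≠ j →
      |(∫ x, φ (v i) (v j) (x i - x j) ∂(posLaw σ L n)) - c₂ * σ ^ 2 * Δ / (n * (n - 1)) * pairKernel w (v i) (v j)| ≤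
        E₀ * (1 + ‖v i - v j‖) ^ 4 := by
    intro v i j hij
    have h2 : Measurable fun q : V3 => (v i, v j, q) := measurable_const.prodMk (measurable_const.prodMk measurable_id)
    have hφm' : Measurable (φ (v i) (v j)) := hφm.comp h2
    exact stub_kinematicAssemblyOfTail_statics σ L n C_CS c₂ C_CLB K b Δ w (v i) (v j) (φ (v i) (v j)) i j hσ hL hn hP
      hCS0 hc₂ hCLB0 hCS hCLB hK hwb hΔ hΔ1 hφm' (hφb _ _) (hφs _ _) (hφi _ _) hij
  -- the dominating function
  have hBterm : ∀ i j : Fin n, Integrable (fun v : Fin n → V3 => (if i = j then 0 else E₀ * (1 + ‖v i - v j‖) ^ 4))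
      (Measure.pi fun _ : Fin n => stdGaussian V3) := fun i j => by
    by_cases hij : i = j
    · simp only [if_pos hij]; exact integrable_const _
    · simp only [if_neg hij]; exact (integral_one_add_norm_sub_le n i j).1.const_mul _
  have hBi : Integrable (fun v : Fin n → V3 => (1 / 2) * ∑ i, ∑ j, (if i = j then 0 else E₀ * (1 + ‖v i - v j‖) ^ 4))
      (Measure.pi fun _ : Fin n => stdGaussian V3) :=
    (integrable_finsetSum _ fun i _ => integrable_finsetSum _ fun j _ => hBterm i j).const_mul _
  -- pointwise domination
  have hpt : ∀ v : Fin n → V3, ‖F v * ((1 / 2) * ∑ i, ∑ j, (if i = j then 0 else ∫ x, φ (v i) (v j) (x i - x j) ∂(posLaw σ L n)) -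
      Δ * (c₂ * σ ^ 2 / (2 * (n * (n - 1)))) * ∑ i, ∑ j, (if i = j then 0 else pairKernel w (v i) (v j)))‖ ≤
      (1 / 2) * ∑ i, ∑ j, (if i = j then 0 else E₀ * (1 + ‖v i - v j‖) ^ 4) := by
    intro v
    have hrw : (1 / 2) * ∑ i, ∑ j, (if i = j then 0 else ∫ x, φ (v i) (v j) (x i - x j) ∂(posLaw σ L n)) -
        Δ * (c₂ * σ ^ 2 / (2 * (n * (n - 1)))) * ∑ i, ∑ j, (if i = j then 0 else pairKernel w (v i) (v j)) =
        (1 / 2) * ∑ i, ∑ j, (if i = j then 0 else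
          ((∫ x, φ (v i) (v j) (x i - x j) ∂(posLaw σ L n)) - c₂ * σ ^ 2 * Δ / (n * (n - 1)) * pairKernel w (v i) (v j))) := by
      rw [show c₂ * σ ^ 2 / (2 * ((n : ℝ) * (n - 1))) = c₂ * σ ^ 2 / (n * (n - 1)) / 2 from
        div_mul_eq_div_div_swap _ _ _]
      rw [Finset.mul_sum, Finset.mul_sum, Finset.mul_sum, ← Finset.sum_sub_distrib]
      refine Finset.sum_congr rfl fun i _ => ?_
      rw [Finset.mul_sum, Finset.mul_sum, Finset.mul_sum, ← Finset.sum_sub_distrib]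
      refine Finset.sum_congr rfl fun j _ => ?_
      split_ifs <;> ring
    rw [hrw, Real.norm_eq_abs, abs_mul, abs_mul, abs_of_pos (by norm_num : (0 : ℝ) < 1 / 2)]
    calc |F v| * (1 / 2 * |∑ i, ∑ j, (if i = j then 0 else
          ((∫ x, φ (v i) (v j) (x i - x j) ∂(posLaw σ L n)) - c₂ * σ ^ 2 * Δ / (n * (n - 1)) * pairKernel w (v i) (v j)))|)
        ≤ 1 * (1 / 2 * |∑ i, ∑ j, (if i = j then 0 else
          ((∫ x, φ (v i) (v j) (x i - x j) ∂(posLaw σ L n)) - c₂ * σ ^ 2 * Δ / (n * (n - 1)) * pairKernel w (v i) (v j)))|) :=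
          mul_le_mul_of_nonneg_right (hFb v) (by positivity)
      _ ≤ 1 / 2 * ∑ i, ∑ j, (if i = j then 0 else E₀ * (1 + ‖v i - v j‖) ^ 4) := by
          rw [one_mul]
          refine mul_le_mul_of_nonneg_left ?_ (by norm_num)
          refine (Finset.abs_sum_le_sum_abs _ _).trans (Finset.sum_le_sum fun i _ => ?_)
          refine (Finset.abs_sum_le_sum_abs _ _).trans (Finset.sum_le_sum fun j _ => ?_)
          by_cases hij : i = j
          · rw [if_pos hij, if_pos hij, abs_zero]
          · rw [if_neg hij, if_neg hij]
            exact hpair v i j hij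
  -- integrate
  refine (norm_integral_le_of_norm_le hBi (ae_of_all _ hpt)).trans ?_
  rw [integral_const_mul, integral_finsetSum _ fun i _ => integrable_finsetSum _ fun j _ => hBterm i j]
  have hij : ∀ i j : Fin n, ∫ v, (if i = j then 0 else E₀ * (1 + ‖v i - v j‖) ^ 4) ∂(Measure.pi fun _ : Fin n => stdGaussian V3) ≤
      (if i = j then 0 else E₀ * (16 * M₄)) := by
    intro i j
    by_cases hij : i = j
    · simp [hij]
    · simp only [if_neg hij]
      rw [integral_const_mul]
      exact mul_le_mul_of_nonneg_left (integral_one_add_norm_sub_le n i j).2 hE₀0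
  have hsum : ∑ i : Fin n, ∫ v, ∑ j, (if i = j then 0 else E₀ * (1 + ‖v i - v j‖) ^ 4) ∂(Measure.pi fun _ : Fin n => stdGaussian V3) ≤
      E₀ * (16 * M₄) * (n * (n - 1)) := by
    calc ∑ i : Fin n, ∫ v, ∑ j, (if i = j then 0 else E₀ * (1 + ‖v i - v j‖) ^ 4) ∂(Measure.pi fun _ : Fin n => stdGaussian V3)
        = ∑ i : Fin n, ∑ j : Fin n, ∫ v, (if i = j then 0 else E₀ * (1 + ‖v i - v j‖) ^ 4) ∂(Measure.pi fun _ : Fin n => stdGaussian V3) :=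
          Finset.sum_congr rfl fun i _ => integral_finsetSum _ fun j _ => hBterm i j
      _ ≤ ∑ i : Fin n, ∑ j : Fin n, (if i = j then 0 else E₀ * (16 * M₄)) :=
          Finset.sum_le_sum fun i _ => Finset.sum_le_sum fun j _ => hij i j
      _ = E₀ * (16 * M₄) * (n * (n - 1)) := by rw [sum_sum_ite_const]
  -- the arithmetic of the constants
  have hEN : E₀ * (n * (n - 1)) ≤ (4 * b * C_CS + 32 * b * C_CLB + 4 * b * Real.pi * σ ^ 2 * K) * (L ^ 3 * Δ ^ 2 + L ^ 2 * Δ) := by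
    have hNle : (n : ℝ) * (n - 1) ≤ 4 * L ^ 6 := by
      have hn0 : (0 : ℝ) ≤ n := Nat.cast_nonneg n
      nlinarith
    rcases hN0.eq_or_lt with hN00 | hNpos
    · rw [← hN00, mul_zero]; positivity
    · set N : ℝ := (n : ℝ) * (n - 1) with hN
      have hE₀N : E₀ * N = 4 * b * C_CS * (Δ * L ^ 2 + Δ ^ 2 * L ^ 3) + 8 * b * C_CLB * Δ ^ 2 / L ^ 3 * N +
          4 * b * Real.pi * σ ^ 2 * K * L ^ 3 * Δ ^ 2 := by
        rw [hE₀]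
        field_simp
      rw [hE₀N]
      have h1 : 8 * b * C_CLB * Δ ^ 2 / L ^ 3 * N ≤ 32 * b * C_CLB * (L ^ 3 * Δ ^ 2) := by
        calc 8 * b * C_CLB * Δ ^ 2 / L ^ 3 * N ≤ 8 * b * C_CLB * Δ ^ 2 / L ^ 3 * (4 * L ^ 6) :=
              mul_le_mul_of_nonneg_left hNle (by positivity)
          _ = 32 * b * C_CLB * (L ^ 3 * Δ ^ 2) := by field_simp; ring
      have h2 : 0 ≤ 32 * b * C_CLB * (L ^ 2 * Δ) := by positivity
      have h3 : 0 ≤ 4 * b * Real.pi * σ ^ 2 * K * (L ^ 2 * Δ) := by positivity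
      nlinarith
  calc 1 / 2 * ∑ i : Fin n, ∫ v, ∑ j, (if i = j then 0 else E₀ * (1 + ‖v i - v j‖) ^ 4) ∂(Measure.pi fun _ : Fin n => stdGaussian V3)
      ≤ 1 / 2 * (E₀ * (16 * M₄) * (n * (n - 1))) := mul_le_mul_of_nonneg_left hsum (by norm_num)
    _ = 8 * M₄ * (E₀ * (n * (n - 1))) := by ring
    _ ≤ 8 * M₄ * ((4 * b * C_CS + 32 * b * C_CLB + 4 * b * Real.pi * σ ^ 2 * K) * (L ^ 3 * Δ ^ 2 + L ^ 2 * Δ)) :=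
        mul_le_mul_of_nonneg_left hEN (by positivity)
    _ = 8 * M₄ * (4 * b * C_CS + 32 * b * C_CLB + 4 * b * Real.pi * σ ^ 2 * K) * (L ^ 3 * Δ ^ 2 + L ^ 2 * Δ) := by ring

end Summit.AtomisticToContinuum.HydrodynamicLimit.Theorems.EnskogCompensator

end
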